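import Literature.NumberTheory.Transcendental.KZCalculusProofs
import Literature.NumberTheory.Transcendental.SemialgebraicMapsProofs

/-!
# Bending the last coordinate: tools for deriving rule (1b) from rules (1a), (2), (3)

Support for the negative side of crux `CompleteModGammaSector` (§7A of
`Cruxes/CompleteModGammaSector/Disproof.lean`, cdisprove gen 1; used by
`Negative/IntegrandAdditivityRedundant.lean`). Bands `σ × [a,b]` in the Newton–Leibniz format
(`bandSet`); the bend `(x, s) ↦ (x, ψ s)` of the last coordinate with its derivative `bendDeriv`
(`det = ψ' s`, `hasFDerivAt_bend`) packaged as a change-of-variables move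
(`bend_mem_changeOfVariablesRel`); the two polynomial bends `ψ₁ s = 2s − s²` of `[0,1]` and
`ψ₂ s = 1 + (s−1)²` of `[1,2]` (semialgebraic, injective, onto); the glued integrand
`hglue f g` (`2(1−s)·f x` below `s = 1`, `2(s−1)·g x` above) and its fibrewise primitive `Hglue`
(semialgebraic on `σ × [0,2]`).
-/

noncomputable section

open MeasureTheory Set
open scoped BigOperators Topology

namespace Summit.KontsevichZagierPeriods.CompleteModGammaSectorNegative

open Literature.NumberTheory.Transcendental
open Literature.NumberTheory.Transcendental.KZ
open Literature.ModelTheory.ExponentialFields (IsSemialgebraic)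
open MvPolynomial (aeval X C)

variable {n : ℕ}

/-! ### Bands over a base -/

/-- The band `σ × [a, b] ⊆ ℝⁿ⁺¹` in the format of the Newton–Leibniz move. -/
def bandSet (σ : Set (Fin n → ℝ)) (a b : ℝ) : Set (Fin (n + 1) → ℝ) :=
  {z | Fin.init z ∈ σ ∧ a ≤ z (Fin.last n) ∧ z (Fin.last n) ≤ b}

/-- Bands with natural-number ends are `ℚ`-semialgebraic. [folklore] -/
theorem isSemialgebraic_bandSet {σ : Set (Fin n → ℝ)} (hσ : IsSemialgebraic ℚ σ) (a b : ℕ) :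
    IsSemialgebraic ℚ (bandSet σ a b) := by
  have h1 : IsSemialgebraic ℚ {z : Fin (n + 1) → ℝ | (a : ℝ) ≤ z (Fin.last n)} := by
    simpa using Literature.ModelTheory.ExponentialFields.isSemialgebraic_setOf_eval_le (k := ℚ) (R := ℝ)
      (a : MvPolynomial (Fin (n + 1)) ℚ) (X (Fin.last n))
  have h2 : IsSemialgebraic ℚ {z : Fin (n + 1) → ℝ | z (Fin.last n) ≤ b} := by
    simpa using Literature.ModelTheory.ExponentialFields.isSemialgebraic_setOf_eval_le (k := ℚ) (R := ℝ)
      (X (Fin.last n)) (b : MvPolynomial (Fin (n + 1)) ℚ)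
  convert (hσ.setOf_init_mem.inter h1).inter h2 using 1
  ext z
  simp only [bandSet, mem_setOf_eq, mem_inter_iff, and_assoc]

/-- Bands are measurable. [folklore] -/
theorem measurableSet_bandSet {σ : Set (Fin n → ℝ)} (hσ : MeasurableSet σ) (a b : ℝ) :
    MeasurableSet (bandSet σ a b) := by
  have hinit : Measurable (Fin.init : (Fin (n + 1) → ℝ) → Fin n → ℝ) :=
    measurable_pi_lambda _ fun i => measurable_pi_apply _
  have hl : Measurable fun z : Fin (n + 1) → ℝ => z (Fin.last n) := measurable_pi_apply _
  refine (hσ.preimage hinit).inter ((measurableSet_le measurable_const hl).inter (measurableSet_le hl measurable_const))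

/-- The slab at level `0` is the band `[0,1]`. [folklore] -/
theorem slabDomain_zero (r : IntegralRep n) : r.slabDomain 0 = bandSet r.domain 0 1 := by
  ext z
  simp [IntegralRep.slabDomain, bandSet]

/-- The slab at level `1` is the band `[1,2]`. [folklore] -/
theorem slabDomain_one (r : IntegralRep n) : r.slabDomain 1 = bandSet r.domain 1 2 := by
  ext z
  simp only [IntegralRep.slabDomain, bandSet, mem_setOf_eq, Nat.cast_one]
  norm_num

/-! ### Bending the last coordinate -/

/-- The map `(x, s) ↦ (x, ψ s)`. -/
def bend (ψ : ℝ → ℝ) (z : Fin (n + 1) → ℝ) : Fin (n + 1) → ℝ :=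
  fun i => if i = Fin.last n then ψ (z (Fin.last n)) else z i

/-- `init (bend ψ z) = init z`. [folklore] -/
theorem init_bend (ψ : ℝ → ℝ) (z : Fin (n + 1) → ℝ) : Fin.init (bend ψ z) = Fin.init z := by
  funext i
  simp [Fin.init, bend, (Fin.castSucc_lt_last i).ne]

/-- `bend ψ z last = ψ (z last)`. [folklore] -/
theorem bend_last (ψ : ℝ → ℝ) (z : Fin (n + 1) → ℝ) : bend ψ z (Fin.last n) = ψ (z (Fin.last n)) := by
  simp [bend]

/-- The derivative of `bend ψ`: identity on the first `n` coordinates, `d` on the last. -/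
def bendDeriv (n : ℕ) (d : ℝ) : (Fin (n + 1) → ℝ) →L[ℝ] (Fin (n + 1) → ℝ) :=
  ContinuousLinearMap.pi fun i =>
    ((if i = Fin.last n then d else (1 : ℝ)) • ContinuousLinearMap.id ℝ ℝ).comp (ContinuousLinearMap.proj i)

/-- `det (bendDeriv d) = d`. [folklore] -/
theorem det_bendDeriv (d : ℝ) : (bendDeriv n d).det = d := by
  rw [bendDeriv, ContinuousLinearMap.det_pi]
  have h : ∀ i : Fin (n + 1), ((if i = Fin.last n then d else (1 : ℝ)) • ContinuousLinearMap.id ℝ ℝ).det =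
      (if i = Fin.last n then d else (1 : ℝ)) := by
    intro i
    rw [ContinuousLinearMap.det, ContinuousLinearMap.toLinearMap_smul, ContinuousLinearMap.coe_id,
      LinearMap.det_smul, LinearMap.det_id, Module.finrank_self]
    simp
  simp_rw [h]
  rw [Finset.prod_ite_eq']
  simp

/-- `bend ψ` has derivative `bendDeriv (ψ' s)` at `z` (`s = z last`). [folklore] -/
theorem hasFDerivAt_bend {ψ : ℝ → ℝ} {d : ℝ} {z : Fin (n + 1) → ℝ}
    (hψ : HasDerivAt ψ d (z (Fin.last n))) : HasFDerivAt (bend ψ) (bendDeriv n d) z := by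
  rw [show bend ψ = fun (z : Fin (n + 1) → ℝ) (i : Fin (n + 1)) =>
      (fun i z => if i = Fin.last n then ψ (z (Fin.last n)) else z i) i z from rfl]
  rw [bendDeriv, hasFDerivAt_pi]
  intro i
  by_cases hi : i = Fin.last n
  · subst hi
    simp only [if_true]
    have h := hψ.comp_hasFDerivAt z (hasFDerivAt_apply (𝕜 := ℝ) (Fin.last n) z)
    refine h.congr_fderiv ?_
    ext v
    simp
  · simp only [hi, if_false]
    refine (hasFDerivAt_apply (𝕜 := ℝ) i z).congr_fderiv ?_
    ext v
    simp

/-- A bend is a change-of-variables move, given the side conditions. [cite: KontsevichZagier2001, §1.2 rule (2)] -/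
theorem bend_mem_changeOfVariablesRel (A S : IntegralRep (n + 1)) (ψ ψ' : ℝ → ℝ)
    (hΦ : IsSemialgebraicMapOn ℚ A.domain (bend ψ))
    (hderiv : ∀ z ∈ A.domain, HasDerivAt ψ (ψ' (z (Fin.last n))) (z (Fin.last n)))
    (hinj : InjOn (bend ψ) A.domain) (himage : S.domain = bend ψ '' A.domain)
    (hint : ∀ z ∈ A.domain, A.integrand z = S.integrand (bend ψ z) * |ψ' (z (Fin.last n))|) :
    of A - of S ∈ changeOfVariablesRel := by
  refine ⟨n + 1, A, S, bend ψ, fun z => bendDeriv n (ψ' (z (Fin.last n))), hΦ,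
    fun z hz => (hasFDerivAt_bend (hderiv z hz)).hasFDerivWithinAt, hinj, himage, fun z hz => ?_, rfl⟩
  rw [det_bendDeriv]
  exact hint z hz

/-- `ψ₁ s = 2s − s² = 1 − (1 − s)²` (increasing bend of `[0,1]` onto itself, `ψ₁' (1) = 0`). -/
def ψ₁ (s : ℝ) : ℝ := 2 * s - s ^ 2
/-- `ψ₂ s = 1 + (s − 1)²` (increasing bend of `[1,2]` onto itself, `ψ₂' (1) = 0`). -/
def ψ₂ (s : ℝ) : ℝ := 1 + (s - 1) ^ 2

/-- `ψ₁' s = 2 − 2s`. [folklore] -/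
theorem hasDerivAt_ψ₁ (s : ℝ) : HasDerivAt ψ₁ (2 - 2 * s) s := by
  have h1 : HasDerivAt (fun x : ℝ => 2 * x - x ^ 2) (2 * 1 - ((2 : ℕ) : ℝ) * s ^ (2 - 1) * 1) s :=
    ((hasDerivAt_id' s).const_mul 2).sub ((hasDerivAt_id' s).pow 2)
  have h2 : (fun x : ℝ => 2 * x - x ^ 2) = ψ₁ := funext fun x => rfl
  rw [h2] at h1
  exact h1.congr_deriv (by push_cast; ring)

/-- `ψ₂' s = 2 (s − 1)`. [folklore] -/
theorem hasDerivAt_ψ₂ (s : ℝ) : HasDerivAt ψ₂ (2 * (s - 1)) s := by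
  have h1 : HasDerivAt (fun x : ℝ => 1 + (x - 1) ^ 2) (((2 : ℕ) : ℝ) * (s - 1) ^ (2 - 1) * 1) s :=
    (((hasDerivAt_id' s).sub_const 1).pow 2).const_add 1
  have h2 : (fun x : ℝ => 1 + (x - 1) ^ 2) = ψ₂ := funext fun x => rfl
  rw [h2] at h1
  exact h1.congr_deriv (by push_cast; ring)

/-- `bend ψ₁` is a `ℚ`-semialgebraic (polynomial) map. [folklore] -/
theorem isSemialgebraicMapOn_bend_ψ₁ {s : Set (Fin (n + 1) → ℝ)} (hs : IsSemialgebraic ℚ s) :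
    IsSemialgebraicMapOn ℚ s (bend ψ₁) := by
  refine (isSemialgebraicMapOn_aeval hs (fun i => if i = Fin.last n then
    (2 * X (Fin.last n) - X (Fin.last n) ^ 2 : MvPolynomial (Fin (n + 1)) ℚ) else X i)).congr ?_
  intro z _
  funext i
  by_cases hi : i = Fin.last n <;> simp [bend, hi, ψ₁]

/-- `bend ψ₂` is a `ℚ`-semialgebraic (polynomial) map. [folklore] -/
theorem isSemialgebraicMapOn_bend_ψ₂ {s : Set (Fin (n + 1) → ℝ)} (hs : IsSemialgebraic ℚ s) :
    IsSemialgebraicMapOn ℚ s (bend ψ₂) := by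
  refine (isSemialgebraicMapOn_aeval hs (fun i => if i = Fin.last n then
    (1 + (X (Fin.last n) - 1) ^ 2 : MvPolynomial (Fin (n + 1)) ℚ) else X i)).congr ?_
  intro z _
  funext i
  by_cases hi : i = Fin.last n <;> simp [bend, hi, ψ₂]

/-- Two tuples agree iff their `init`s and last coordinates agree. [folklore] -/
theorem eq_of_init_eq_of_last_eq {z w : Fin (n + 1) → ℝ} (h1 : Fin.init z = Fin.init w)
    (h2 : z (Fin.last n) = w (Fin.last n)) : z = w := by
  rw [← Fin.snoc_init_self z, ← Fin.snoc_init_self w, h1, h2]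

/-- `bend ψ₁` is injective on the band `[0,1]`. [folklore] -/
theorem injOn_bend_ψ₁ (σ : Set (Fin n → ℝ)) : InjOn (bend ψ₁) (bandSet σ 0 1) := by
  intro z hz w hw h
  have hl : ψ₁ (z (Fin.last n)) = ψ₁ (w (Fin.last n)) := by
    have := congrFun h (Fin.last n)
    simpa [bend] using this
  have hi : Fin.init z = Fin.init w := by
    have := congrArg Fin.init h
    rwa [init_bend, init_bend] at this
  refine eq_of_init_eq_of_last_eq hi ?_
  have hz1 := hz.2.2
  have hw1 := hw.2.2
  have hsq : (1 - z (Fin.last n)) ^ 2 = (1 - w (Fin.last n)) ^ 2 := by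
    simp only [ψ₁] at hl
    nlinarith [hl]
  have := (pow_left_inj₀ (by linarith) (by linarith) two_ne_zero).mp hsq
  linarith

/-- `bend ψ₂` is injective on the band `[1,2]`. [folklore] -/
theorem injOn_bend_ψ₂ (σ : Set (Fin n → ℝ)) : InjOn (bend ψ₂) (bandSet σ 1 2) := by
  intro z hz w hw h
  have hl : ψ₂ (z (Fin.last n)) = ψ₂ (w (Fin.last n)) := by
    have := congrFun h (Fin.last n)
    simpa [bend] using this
  have hi : Fin.init z = Fin.init w := by
    have := congrArg Fin.init h
    rwa [init_bend, init_bend] at this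
  refine eq_of_init_eq_of_last_eq hi ?_
  have hz1 := hz.2.1
  have hw1 := hw.2.1
  have hsq : (z (Fin.last n) - 1) ^ 2 = (w (Fin.last n) - 1) ^ 2 := by
    simp only [ψ₂] at hl
    linarith
  have := (pow_left_inj₀ (by linarith) (by linarith) two_ne_zero).mp hsq
  linarith

/-- `bend ψ₁` maps the band `[0,1]` onto itself. [folklore] -/
theorem image_bend_ψ₁ (σ : Set (Fin n → ℝ)) : bend ψ₁ '' bandSet σ 0 1 = bandSet σ 0 1 := by
  ext w
  simp only [mem_image]
  constructor
  · rintro ⟨z, hz, rfl⟩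
    refine ⟨by rw [init_bend]; exact hz.1, ?_, ?_⟩
    · rw [bend_last, ψ₁]; nlinarith [hz.2.1, hz.2.2]
    · rw [bend_last, ψ₁]; nlinarith [hz.2.1, hz.2.2]
  · intro hw
    set t := w (Fin.last n) with ht
    have ht0 : 0 ≤ t := hw.2.1
    have ht1 : t ≤ 1 := hw.2.2
    set u := Real.sqrt (1 - t) with hu
    have hu0 : 0 ≤ u := Real.sqrt_nonneg _
    have hu1 : u ≤ 1 := by
      rw [hu, Real.sqrt_le_one]; linarith
    have husq : u ^ 2 = 1 - t := Real.sq_sqrt (by linarith)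
    refine ⟨bend (fun _ => 1 - u) w, ⟨by rw [init_bend]; exact hw.1, ?_, ?_⟩, ?_⟩
    · rw [bend_last]; linarith
    · rw [bend_last]; linarith
    · refine eq_of_init_eq_of_last_eq (by rw [init_bend, init_bend]) ?_
      rw [bend_last, bend_last, ψ₁]
      nlinarith [husq]

/-- `bend ψ₂` maps the band `[1,2]` onto itself. [folklore] -/
theorem image_bend_ψ₂ (σ : Set (Fin n → ℝ)) : bend ψ₂ '' bandSet σ 1 2 = bandSet σ 1 2 := by
  ext w
  simp only [mem_image]
  constructor
  · rintro ⟨z, hz, rfl⟩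
    refine ⟨by rw [init_bend]; exact hz.1, ?_, ?_⟩
    · rw [bend_last, ψ₂]; nlinarith [hz.2.1, hz.2.2]
    · rw [bend_last, ψ₂]; nlinarith [hz.2.1, hz.2.2]
  · intro hw
    set t := w (Fin.last n) with ht
    have ht0 : 1 ≤ t := hw.2.1
    have ht1 : t ≤ 2 := hw.2.2
    set u := Real.sqrt (t - 1) with hu
    have hu0 : 0 ≤ u := Real.sqrt_nonneg _
    have hu1 : u ≤ 1 := by
      rw [hu, Real.sqrt_le_one]; linarith
    have husq : u ^ 2 = t - 1 := Real.sq_sqrt (by linarith)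
    refine ⟨bend (fun _ => 1 + u) w, ⟨by rw [init_bend]; exact hw.1, ?_, ?_⟩, ?_⟩
    · rw [bend_last]; linarith
    · rw [bend_last]; linarith
    · refine eq_of_init_eq_of_last_eq (by rw [init_bend, init_bend]) ?_
      rw [bend_last, bend_last, ψ₂]
      nlinarith [husq]

/-! ### The glued integrand and its primitive -/

/-- The glued integrand on `σ × [0,2]`: `2(1−s)·f x` below `s = 1`, `2(s−1)·g x` above. -/
def hglue (f g : (Fin n → ℝ) → ℝ) (z : Fin (n + 1) → ℝ) : ℝ :=
  if z (Fin.last n) ≤ 1 then 2 * (1 - z (Fin.last n)) * f (Fin.init z)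
  else 2 * (z (Fin.last n) - 1) * g (Fin.init z)

/-- Its fibrewise primitive: `(2s − s²)·f x` below `s = 1`, `f x + (s−1)²·g x` above. -/
def Hglue (f g : (Fin n → ℝ) → ℝ) (z : Fin (n + 1) → ℝ) : ℝ :=
  if z (Fin.last n) ≤ 1 then (2 * z (Fin.last n) - z (Fin.last n) ^ 2) * f (Fin.init z)
  else f (Fin.init z) + (z (Fin.last n) - 1) ^ 2 * g (Fin.init z)

section Semialg

variable {σ : Set (Fin n → ℝ)} {f g : (Fin n → ℝ) → ℝ}

/-- A polynomial in the last coordinate times `f ∘ init` is semialgebraic on a band. [folklore] -/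
theorem isSemialgebraicFunOn_poly_mul_comp_init (hσ : IsSemialgebraic ℚ σ) (hf : IsSemialgebraicFunOn ℚ σ f)
    (p : MvPolynomial (Fin (n + 1)) ℚ) (a b : ℕ) :
    IsSemialgebraicFunOn ℚ (bandSet σ a b) (fun z => aeval z p * f (Fin.init z)) := by
  have hB := isSemialgebraic_bandSet hσ a b
  have h1 : IsSemialgebraicFunOn ℚ (bandSet σ a b) (fun z => aeval z p) := isSemialgebraicFunOn_aeval hB p
  have h2 : IsSemialgebraicFunOn ℚ (bandSet σ a b) (fun z => f (Fin.init z)) :=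
    hf.comp_init.mono (fun _ hz => hz.1) hB
  exact IsSemialgebraicFunOn.mul_holds h1 h2

/-- `hglue` is semialgebraic on the band `[0,2]`. [folklore] -/
theorem isSemialgebraicFunOn_hglue (hσ : IsSemialgebraic ℚ σ) (hf : IsSemialgebraicFunOn ℚ σ f)
    (hg : IsSemialgebraicFunOn ℚ σ g) : IsSemialgebraicFunOn ℚ (bandSet σ 0 2) (hglue f g) := by
  have hp1 := isSemialgebraicFunOn_poly_mul_comp_init hσ hf (2 * (1 - X (Fin.last n))) 0 1
  have hp2 := isSemialgebraicFunOn_poly_mul_comp_init hσ hg (2 * (X (Fin.last n) - 1)) 1 2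
  have hunion : bandSet σ (0 : ℝ) 2 = bandSet σ 0 1 ∪ bandSet σ 1 2 := by
    ext z
    simp only [bandSet, mem_setOf_eq, mem_union]
    constructor
    · intro h
      rcases le_total (z (Fin.last n)) 1 with h1 | h1
      · exact Or.inl ⟨h.1, h.2.1, h1⟩
      · exact Or.inr ⟨h.1, h1, h.2.2⟩
    · rintro (h | h)
      · exact ⟨h.1, h.2.1, by linarith [h.2.2]⟩
      · exact ⟨h.1, by linarith [h.2.1], h.2.2⟩
  norm_num at hp1 hp2
  rw [hunion]
  refine IsSemialgebraicFunOn.union hp1 hp2 ?_ ?_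
  · intro z hz
    have h1 : z (Fin.last n) ≤ 1 := by simpa using hz.2.2
    simp [hglue, h1]
  · intro z hz
    have h1 : 1 ≤ z (Fin.last n) := by simpa using hz.2.1
    by_cases h : z (Fin.last n) ≤ 1
    · have : z (Fin.last n) = 1 := le_antisymm h h1
      simp [hglue, this]
    · simp [hglue, h]

/-- `Hglue` is semialgebraic on the band `[0,2]`. [folklore] -/
theorem isSemialgebraicFunOn_Hglue (hσ : IsSemialgebraic ℚ σ) (hf : IsSemialgebraicFunOn ℚ σ f)
    (hg : IsSemialgebraicFunOn ℚ σ g) : IsSemialgebraicFunOn ℚ (bandSet σ 0 2) (Hglue f g) := by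
  have hp1 := isSemialgebraicFunOn_poly_mul_comp_init hσ hf (2 * X (Fin.last n) - X (Fin.last n) ^ 2) 0 1
  have hp2a := isSemialgebraicFunOn_poly_mul_comp_init hσ hf 1 1 2
  have hp2b := isSemialgebraicFunOn_poly_mul_comp_init hσ hg ((X (Fin.last n) - 1) ^ 2) 1 2
  have hp2 : IsSemialgebraicFunOn ℚ (bandSet σ (1 : ℕ) 2)
      (fun z => f (Fin.init z) + (z (Fin.last n) - 1) ^ 2 * g (Fin.init z)) := by
    refine (IsSemialgebraicFunOn.add_holds hp2a hp2b).congr fun z _ => ?_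
    simp
  have hunion : bandSet σ (0 : ℝ) 2 = bandSet σ 0 1 ∪ bandSet σ 1 2 := by
    ext z
    simp only [bandSet, mem_setOf_eq, mem_union]
    constructor
    · intro h
      rcases le_total (z (Fin.last n)) 1 with h1 | h1
      · exact Or.inl ⟨h.1, h.2.1, h1⟩
      · exact Or.inr ⟨h.1, h1, h.2.2⟩
    · rintro (h | h)
      · exact ⟨h.1, h.2.1, by linarith [h.2.2]⟩
      · exact ⟨h.1, by linarith [h.2.1], h.2.2⟩
  norm_num at hp1 hp2
  rw [hunion]
  refine IsSemialgebraicFunOn.union hp1 hp2 ?_ ?_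
  · intro z hz
    have h1 : z (Fin.last n) ≤ 1 := by simpa using hz.2.2
    simp [Hglue, h1]
  · intro z hz
    have h1 : 1 ≤ z (Fin.last n) := by simpa using hz.2.1
    by_cases h : z (Fin.last n) ≤ 1
    · have : z (Fin.last n) = 1 := le_antisymm h h1
      simp [Hglue, this]
      norm_num
    · simp [Hglue, h]

end Semialg

end Summit.KontsevichZagierPeriods.CompleteModGammaSectorNegative
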